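import Mathlib
import Summits.CriticalPhenomena.PercolationContinuityZ3.Theorems.PercNearOneGluingNoHeavyLowerTailOrientedAntipodalHallSectionDecomposition

/-!
# SD-certificates (section-decomposition certificates) for the Hall count — definition and soundness

Helper file for crux `stmt-CriticalPhenomena-4575` (`NoHeavyLowerTail`, route `PercNearOneGluingNoHeavy`), hull-port seat
`prim-hp-7` (generation 54); `--supports stmt-CriticalPhenomena-4575`.  Defines ONE inductive predicate `SDCert` (a certificate
FORMAT, like prim-ineq-gen-3's ordered two-sided certificates but recursive) and proves it sound and hereditary; everything else is
in `…SectionDecomposition` (the one-step Ahlswede–Daykin split of the goods above a family).  Memo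
`prim-hp-7/FROM-prim-hp-7-g54-THREE-PETALS.md` §8: SD-certificates exist for all seven known Hall-true families WITHOUT an antipodal
ordered Marica–Schönheim certificate (`TS2-CEX-g54.json`); the HYBRID 'SD split or node certificate' has no failure in 1.1·10⁸
random co-intersecting families (Conjecture H).  (prim-hp-7 gen 54, 2026-08-22.)
-/

namespace Summit.CriticalPhenomena.PercolationContinuityZ3.Theorems

namespace OrientedAntipodalHall

open Finset AntipodalStrongHarris AntipodalStrongHarris.Lab
open scoped FinsetFamily

variable {α : Type*} [DecidableEq α] {k : ℕ}

/-- **SD-certificates** (section-decomposition certificates) for the Hall count of a family `D` of subsets of `S` with respect to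
the goods of a pair of labellings `(g, h)`: the empty family is certified; on the empty ground set a family (necessarily `⊆ {∅}`) is
certified when `g ∅ = A` and `h ∅ = B`; and `D` on `S` is certified if for some `e ∈ S` both the projected family `{X \ e}` (for the
section pair `(g (insert e ·), h)`) and the doubleton family `{X ∈ D : e ∉ X, insert e X ∈ D}` (for `(g, h (insert e ·))`) are
certified on `S \ e`. -/
inductive SDCert : Finset α → (Finset α → Lab k) → (Finset α → Lab k) → Finset (Finset α) → Prop
  | nil (S : Finset α) (g h : Finset α → Lab k) : SDCert S g h ∅
  | leaf (g h : Finset α → Lab k) (D : Finset (Finset α)) (hg : g ∅ = top) (hh : h ∅ = bot) (hD : D ⊆ {∅}) :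
      SDCert ∅ g h D
  | split (S : Finset α) (g h : Finset α → Lab k) (D : Finset (Finset α)) (e : α) (he : e ∈ S)
      (h₁ : SDCert (S.erase e) (fun U => g (insert e U)) h (D.image fun X => X.erase e))
      (h₀ : SDCert (S.erase e) g (fun U => h (insert e U)) (D.filter fun X => e ∉ X ∧ insert e X ∈ D)) :
      SDCert S g h D

/-- SD-certificates are hereditary: every sub-family of a certified family is certified (by the same splits). -/
theorem SDCert.mono {S : Finset α} {g h : Finset α → Lab k} {D : Finset (Finset α)} (hc : SDCert S g h D) :
    ∀ D' ⊆ D, SDCert S g h D' := by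
  induction hc with
  | nil S g h =>
      intro D' hD'
      rw [subset_empty.1 hD']
      exact SDCert.nil S g h
  | leaf g h D hg hh hD =>
      intro D' hD'
      exact SDCert.leaf g h D' hg hh (hD'.trans hD)
  | split S g h D e he h₁ h₀ ih₁ ih₀ =>
      intro D' hD'
      refine SDCert.split S g h D' e he (ih₁ _ (image_subset_image hD')) (ih₀ _ ?_)
      intro X hX
      rw [mem_filter] at hX ⊢
      exact ⟨hD' hX.1, hX.2.1, hD' hX.2.2⟩

/-- **Soundness of SD-certificates (counting form).**  A certified family `D` of subsets of `S` has at most as many members as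
there are goods of `(g, h)` on `S` lying above a member of `D`. -/
theorem SDCert.card_le_card_goods {S : Finset α} {g h : Finset α → Lab k} {D : Finset (Finset α)}
    (hc : SDCert S g h D) :
    (∀ X ∈ D, X ⊆ S) → #D ≤ #{U ∈ S.powerset | g U = top ∧ h (S \ U) = bot ∧ ∃ X ∈ D, X ⊆ U} := by
  induction hc with
  | nil S g h => intro _; simp
  | leaf g h D hg hh hD =>
      intro _
      rcases D.eq_empty_or_nonempty with rfl | hne
      · simp
      · have hD1 : #D ≤ 1 := (card_le_card hD).trans (by simp)
        have hmem : (∅ : Finset α) ∈ ({U ∈ (∅ : Finset α).powerset | g U = top ∧ h (∅ \ U) = bot ∧ ∃ X ∈ D, X ⊆ U} :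
            Finset (Finset α)) := by
          rw [mem_filter, mem_powerset]
          obtain ⟨X, hX⟩ := hne
          have hX0 : X = ∅ := mem_singleton.1 (hD hX)
          exact ⟨subset_rfl, hg, by rw [sdiff_empty]; exact hh, X, hX, by rw [hX0]⟩
        exact hD1.trans (Nat.one_le_iff_ne_zero.mpr (card_ne_zero.mpr ⟨∅, hmem⟩))
  | split S g h D e he h₁ h₀ ih₁ ih₀ =>
      intro hDS
      have hDS₁ : ∀ Y ∈ D.image (fun X => X.erase e), Y ⊆ S.erase e := by
        intro Y hY
        obtain ⟨X, hX, rfl⟩ := mem_image.1 hY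
        exact erase_subset_erase e (hDS X hX)
      have hDS₀ : ∀ X ∈ D.filter (fun X => e ∉ X ∧ insert e X ∈ D), X ⊆ S.erase e := by
        intro X hX
        rw [mem_filter] at hX
        intro x hx
        exact mem_erase.2 ⟨fun hxe => hX.2.1 (hxe ▸ hx), hDS X hX.1 hx⟩
      have := card_filter_goods_ge_sections S he g h D
      have e1 := ih₁ hDS₁
      have e0 := ih₀ hDS₀
      beta_reduce at e1 e0
      rw [card_eq_card_doubletons_add_card_image_erase D e]
      omega

/-- **Soundness of SD-certificates (SDR form, single labelling).**  If a family `D` of subsets of `S` has an SD-certificate for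
`(f, f)`, then (the certificate being hereditary) Hall's theorem gives DISTINCT goods above the members: an injective `φ` on `D`
with `X ⊆ φ X ⊆ S`, `f (φ X) = A`, `f (S \ φ X) = B`. -/
theorem SDCert.exists_injective_good_above (S : Finset α) (f : Finset α → Lab k) (D : Finset (Finset α))
    (hDS : ∀ X ∈ D, X ⊆ S) (hc : SDCert S f f D) :
    ∃ φ : D → Finset α, Function.Injective φ ∧
      ∀ X : D, (X : Finset α) ⊆ φ X ∧ φ X ⊆ S ∧ f (φ X) = top ∧ f (S \ φ X) = bot := by
  classical
  let t : D → Finset (Finset α) := fun X =>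
    {U ∈ S.powerset | f U = top ∧ f (S \ U) = bot ∧ (X : Finset α) ⊆ U}
  have hHall : ∀ s : Finset D, #s ≤ #(s.biUnion t) := by
    intro s
    set D' : Finset (Finset α) := s.map (Function.Embedding.subtype _) with hD'
    have hD'sub : D' ⊆ D := by
      intro X hX
      obtain ⟨x, -, rfl⟩ := mem_map.mp hX
      exact x.2
    have hcard : #s = #D' := (card_map _).symm
    have hle := (hc.mono D' hD'sub).card_le_card_goods (fun X hX => hDS X (hD'sub hX))
    have hgoods : {U ∈ S.powerset | f U = top ∧ f (S \ U) = bot ∧ ∃ X ∈ D', X ⊆ U} ⊆ s.biUnion t := by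
      intro U hU
      rw [mem_filter, mem_powerset] at hU
      obtain ⟨hUS, hUtop, hUbot, X, hX, hXU⟩ := hU
      obtain ⟨x, hx, rfl⟩ := mem_map.mp hX
      rw [mem_biUnion]
      refine ⟨x, hx, ?_⟩
      simp only [t, mem_filter, mem_powerset]
      exact ⟨hUS, hUtop, hUbot, hXU⟩
    calc #s = #D' := hcard
      _ ≤ #{U ∈ S.powerset | f U = top ∧ f (S \ U) = bot ∧ ∃ X ∈ D', X ⊆ U} := hle
      _ ≤ #(s.biUnion t) := card_le_card hgoods
  obtain ⟨φ, hφinj, hφ⟩ := (all_card_le_biUnion_card_iff_exists_injective t).mp hHall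
  refine ⟨φ, hφinj, fun X => ?_⟩
  have hX := hφ X
  simp only [t, mem_filter, mem_powerset] at hX
  exact ⟨hX.2.2.2, hX.1, hX.2.1, hX.2.2.1⟩

end OrientedAntipodalHall

end Summit.CriticalPhenomena.PercolationContinuityZ3.Theorems
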